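import Literature.AnabelianGeometry.EtaleTheta.Discharge.Sec5Cor512ModelCaseGaloisBase
import Literature.AnabelianGeometry.EtaleTheta.Discharge.Sec5OfConnectedTemperoid
import Literature.AnabelianGeometry.EtaleTheta.Discharge.Sec4BaseEquivOfTemperoids
import Literature.AlgebraicGeometry.Frobenioids.PreFrobenioidDataOfFunctor

/-!
# [EtTh] Corollary 5.12 (i)(ii)(iii) at the GENUINE §5 data over `B^temp(Π^tp_X)⁰`: every binder of the model case
# DISCHARGED except print's §1 line-bundle sentences

Mochizuki, *The étale theta function and its Frobenioid-theoretic manifestations*, Publ. RIMS **45** (2009), Cor. 5.12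
pp.339–340 (PDF pp.113–114), proof p.340 l.−8 – p.341 l.9 (PDF pp.114–115); Def. 4.1 (ii), (iv)(a) p.313 (PDF p.87)
("`A` is Frobenius-trivial, Galois, and `μ_N`-saturated"); Prop. 4.2 (iii) p.314 (PDF p.88) ("`α` is of base-Frobenius type …
`s'_N, s''_N : A_N → B_N` are base-equivalent pre-steps"); §5 p.330 (PDF p.104) ("it follows that `B_N` is Aut-ample"), p.331
(PDF p.105) l.39–41 ("`Π^tp_X ↠ Aut_D(B_N^bs)` [cf. Definition 4.1, (ii)]")
[cite: MochizukiEtTh2009, Cor 5.12 p.339–341 (PDF pp.113–115); Def 4.1 p.313 (PDF p.87); Prop 4.2 (iii) p.314 (PDF p.88); §5 p.330–331 (PDF pp.104–105)];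
Mochizuki, *Semi-graphs of anabelioids*, Publ. RIMS **42** (2006), Def. 3.1 (iv), Rmk. 3.1.6 p.34
[cite: MochizukiSemiAnbd2006, Rmk 3.1.6 p.34].

PROOF-ONLY sequel (cell abc-iut, block F, seat abc-iut-f-112 gen 3; FACT-LIST rows F-0505 `ConstantMultiple.IsoClassesDistinct`,
F-0503 `ExistsLinearIota`, F-0501 `ConstantMultipleIndeterminacy`, F-0502 `ConstantMultipleIndeterminacyOfSystems`) of
`Sec5Cor512ModelCase.lean` (gen 2, p436682) and `Sec5Cor512ModelCaseGaloisBase.lean` (gen 3, p444068), AT abc-iut-L2-t4's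
genuine §5 datum `𝔉 := ThetaFrobenioid.ofConnectedTemperoidData h Q odd_l R ιX K' constEmb constEmb_injective hinvc hinvp`
over the setting `BiKummerSetting.mkOfConnectedTemperoid X tf hZ hP NH A₀ hA₀ hA₀'` on the GENUINE connected base
`D := B^temp(Π^tp_X)⁰ = ConnectedPart (BTemp Π^tp_X)` (`Discharge/Sec5OfConnectedTemperoid.lean`).  For EVERY Cor. 5.12 datum
`Rm : ConstantMultiple.RootMorphismData 𝔉 Vv` the binders of the model case are THEOREMS here:
* `h𝔉 := rfl` (the operations are the model's, `ofBiKummerData_pre`);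
* `hΦd := h.isDivisorial`, `hBg := h.isGroupLike_rat` ([FrdI] Thm. 5.2 standing hypotheses `ModelFrobenioid.Hypotheses`);
* `hA := R.αData.isFrobeniusTrivial` — `A_N` IS Frobenius-trivial: the `N`-domain of an `N`-th root is the domain of the
  base-Frobenius-type `α` (Prop. 4.2 (iii)), whose datum records Def. 4.1 (iv)(a);
* `hAmp := autAmpleBN_ofConnectedTemperoidData` (abc-iut-L2-t4: "`B_N` is Aut-ample", p.330, a theorem at this datum);
* `hGal` — `B_N^bs` IS Galois: `A_N^bs` is Galois (Def. 4.1 (iv)(a), `R.αData.isGalois`) and `(s^⊓_N)^bs : A_N^bs ⥲ B_N^bs`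
  (`BiKummerSetting.NthRoot.baseIso`, Prop. 4.2 (iii) pre-step) transports Galois objects (abc-iut lineage
  `GaloisObjects.isGaloisObj_of_iso`, [SemiAnbd] Def. 3.1 (iv)) — `BiKummerSetting.NthRoot.isGaloisObj_BN_base_obj`; hence
  `End_D(B_N^bs) = Aut_D(B_N^bs)` ([SemiAnbd] Rmk. 3.1.6, p444068).
What remains NAMED is exactly print's §1 input, untyped at the interface (sub-DAG plan/L2/SUBDAG-EtTh-Cor512.md row C512-L02):
"all positive tensor powers of these line bundles are nontrivial" (p.341 l.5–6) in model form — `hL` (the class of `B_N` is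
not in `Div_B(B(B_N^bs))`), `hL'` (no positive power of the class of `B_{N'}` is) — and, for (ii), the two clauses about the
`N'`-datum that `RootMorphismData` carries only through the vocabulary stub `Vv` (`hA'`: `A_{N'}` Frobenius-trivial; `hs'`:
`s^⊓_{N'}` a pre-step; Prop. 4.2 (iii) for `N'`).
No definition, no new `Prop`, no instance; nothing landed is edited.  Cor. 5.12 lies outside the [IUTchIII] Cor. 3.12 cone;
no side is taken on Cor. 3.12 or on any author; nothing asserts that such data exist for an actual curve; typed ≠ proved
except the theorems below.
-/

noncomputable section

namespace Literature.AnabelianGeometry.EtaleTheta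

open CategoryTheory Opposite Literature.AlgebraicGeometry.Frobenioids Literature.AnabelianGeometry.SemiGraphs

universe u₀ v₀ w

/-! ### `B_N^bs` is Galois, for every `N`-th root over the genuine connected setting -/

namespace BiKummerSetting

variable {K : Type u₀} [Field K] {X : SemiGraphs.TemperedArithmeticGroup.{u₀} K} {D₀ : Type u₀} [Category.{v₀} D₀]
  {V : FrdIMonoidStub.{w}} {T₀ : RealifiedDivisorMonoids (D₀ := D₀) V}
  {VD : FrdICatStub.{u₀ + 1, u₀, w} (ConnectedPart (BTemp X.Pi))}
  {tf : TemperedFrobenioid T₀ (ConnectedPart (BTemp X.Pi)) VD} {hZ : tf.monoidType = MonoidType.Z}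
  {hP : ∀ A : (ConnectedPart (BTemp X.Pi))ᵒᵖ, IsPerfect (tf.Φ.carrier A)}
  {NH : Subgroup (Field.absoluteGaloisGroup K) → tf.category → ℕ+ → Prop} {A₀ : tf.category}
  {hA₀ : PreFrobenioid.IsFrobeniusTrivial tf.toElem A₀} {hA₀' : SemiGraphs.IsGaloisObj A₀.base.obj}

/-- **`B_N^bs` is Galois** (as §5 p.331 (PDF p.105) uses: "`Π^tp_X ↠ Aut_D(B_N^bs)` [cf. Definition 4.1, (ii)]"): for any `N`-th root
`R` of a fraction-pair over the genuine connected setting, the underlying `Π^tp_X`-set of `B_N^bs` is a Galois object of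
`B^temp(Π^tp_X)` — `A_N^bs` is Galois (Def. 4.1 (iv)(a) for the base-Frobenius-type `α : A_N → A`, `R.αData.isGalois`) and the
pre-step `s^⊓_N` gives `(s^⊓_N)^bs : A_N^bs ⥲ B_N^bs` (Prop. 4.2 (iii)); Galois objects are isomorphism-invariant.
[cite: MochizukiEtTh2009, Def 4.1 (iv) p.313 (PDF p.87); Prop 4.2 (iii) p.314 (PDF p.88); §5 p.331 (PDF p.105)]
[cite: MochizukiSemiAnbd2006, Def 3.1 (iv) p.33] -/
theorem NthRoot.isGaloisObj_BN_base_obj {A B : (mkOfConnectedTemperoid X tf hZ hP NH A₀ hA₀ hA₀').C}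
    {f : (mkOfConnectedTemperoid X tf hZ hP NH A₀ hA₀ hA₀').biratUnits A}
    {P : (mkOfConnectedTemperoid X tf hZ hP NH A₀ hA₀ hA₀').FractionPair f B} {N : ℕ+}
    {pullFrac : ∀ {A A' : (mkOfConnectedTemperoid X tf hZ hP NH A₀ hA₀ hA₀').C} (_ : A' ⟶ A),
      (mkOfConnectedTemperoid X tf hZ hP NH A₀ hA₀ hA₀').biratUnits A →
        (mkOfConnectedTemperoid X tf hZ hP NH A₀ hA₀ hA₀').biratUnits A'}
    (R : (mkOfConnectedTemperoid X tf hZ hP NH A₀ hA₀ hA₀').NthRoot f P N pullFrac) :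
    SemiGraphs.IsGaloisObj R.BN.base.obj :=
  GaloisObjects.isGaloisObj_of_iso X.isTempered
    ((connectedObjects (BTemp X.Pi)).ι.mapIso
      (NthRoot.baseIso (mkOfConnectedTemperoid X tf hZ hP NH A₀ hA₀ hA₀') R)).symm
    R.αData.isGalois

/-- `A_N` is Frobenius-trivial (Def. 4.1 (iv)(a) for `α : A_N → A` of base-Frobenius type, Prop. 4.2 (iii)), read in the
operations of the model (`PreFrobenioidData.ofModel`).  [cite: MochizukiEtTh2009, Def 4.1 (iv) p.313 (PDF p.87); Prop 4.2 (iii) p.314 (PDF p.88)] -/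
theorem NthRoot.isFrobeniusTrivial_AN_ofModel {A B : (mkOfConnectedTemperoid X tf hZ hP NH A₀ hA₀ hA₀').C}
    {f : (mkOfConnectedTemperoid X tf hZ hP NH A₀ hA₀ hA₀').biratUnits A}
    {P : (mkOfConnectedTemperoid X tf hZ hP NH A₀ hA₀ hA₀').FractionPair f B} {N : ℕ+}
    {pullFrac : ∀ {A A' : (mkOfConnectedTemperoid X tf hZ hP NH A₀ hA₀ hA₀').C} (_ : A' ⟶ A),
      (mkOfConnectedTemperoid X tf hZ hP NH A₀ hA₀ hA₀').biratUnits A →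
        (mkOfConnectedTemperoid X tf hZ hP NH A₀ hA₀ hA₀').biratUnits A'}
    (R : (mkOfConnectedTemperoid X tf hZ hP NH A₀ hA₀ hA₀').NthRoot f P N pullFrac) :
    (PreFrobenioidData.ofModel tf.divisorMonoid tf.ratFnFunctor tf.divBNatTrans).IsFrobeniusTrivial R.AN :=
  (PreFrobenioidData.ofFunctor_isFrobeniusTrivial _ _).mpr R.αData.isFrobeniusTrivial

end BiKummerSetting

/-! ### Cor. 5.12 at `ofConnectedTemperoidData` -/

namespace ThetaFrobenioid

variable {K : Type u₀} [Field K] {X : SemiGraphs.TemperedArithmeticGroup.{u₀} K} {D₀ : Type u₀} [Category.{v₀} D₀]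
  {V : FrdIMonoidStub.{w}} {T₀ : RealifiedDivisorMonoids (D₀ := D₀) V}
  {VD : FrdICatStub.{u₀ + 1, u₀, w} (ConnectedPart (BTemp X.Pi))}
  {tf : TemperedFrobenioid T₀ (ConnectedPart (BTemp X.Pi)) VD} {hZ : tf.monoidType = MonoidType.Z}
  {hP : ∀ A : (ConnectedPart (BTemp X.Pi))ᵒᵖ, IsPerfect (tf.Φ.carrier A)}
  {NH : Subgroup (Field.absoluteGaloisGroup K) → tf.category → ℕ+ → Prop} {A₀ : tf.category}
  {hA₀ : PreFrobenioid.IsFrobeniusTrivial tf.toElem A₀} {hA₀' : SemiGraphs.IsGaloisObj A₀.base.obj}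
  {pullFrac : ∀ {A A' : (BiKummerSetting.mkOfConnectedTemperoid X tf hZ hP NH A₀ hA₀ hA₀').C} (_ : A' ⟶ A),
    (BiKummerSetting.mkOfConnectedTemperoid X tf hZ hP NH A₀ hA₀ hA₀').biratUnits A →
      (BiKummerSetting.mkOfConnectedTemperoid X tf hZ hP NH A₀ hA₀ hA₀').biratUnits A'}
  {lv N : ℕ+} {T : ThetaEnvData.{max u₀ w} N}
  {θ : (BiKummerSetting.mkOfConnectedTemperoid X tf hZ hP NH A₀ hA₀ hA₀').biratUnits
    (BiKummerSetting.mkOfConnectedTemperoid X tf hZ hP NH A₀ hA₀ hA₀').Aodot}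
  {Bl : (BiKummerSetting.mkOfConnectedTemperoid X tf hZ hP NH A₀ hA₀ hA₀').C}
  {Pl : (BiKummerSetting.mkOfConnectedTemperoid X tf hZ hP NH A₀ hA₀ hA₀').FractionPair θ Bl}
  {Rl : (BiKummerSetting.mkOfConnectedTemperoid X tf hZ hP NH A₀ hA₀ hA₀').NthRoot θ Pl lv pullFrac}
  (h : ModelFrobenioid.Hypotheses tf.divisorMonoid tf.ratFnFunctor)
  (Q : FrobenioidTheta.ThetaSubquotientStub.{w} (ConnectedPart (BTemp X.Pi))) (odd_l : Odd (lv : ℕ))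
  (R : (BiKummerSetting.mkOfConnectedTemperoid X tf hZ hP NH A₀ hA₀ hA₀').NthRoot Rl.root Rl.pair N pullFrac)
  (ιX : T.PiX ≃ₜ* X.Pi) (K' : Type w) [Field K'] (constEmb : K'ˣ →* tf.biratUnitsModel R.BN)
  (constEmb_injective : Function.Injective constEmb)
  (hinvc : ∀ g : Aut R.AN.base,
    pull tf.divisorMonoid g.hom (ModelFrobenioid.div R.pair.num) = ModelFrobenioid.div R.pair.num)
  (hinvp : ∀ y : T.PiX, y ∈ T.PiYdd →
    pull tf.divisorMonoid ((BiKummerSetting.mkOfConnectedTemperoid X tf hZ hP NH A₀ hA₀ hA₀').galoisSurj R.AN.base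
      R.αData.isGalois (ιX y)).hom (ModelFrobenioid.div R.pair.den) = ModelFrobenioid.div R.pair.den)
  {Vv : FrobenioidThetaBiKummer.BiKummerVocabStub
    (ofConnectedTemperoidData h Q odd_l R ιX K' constEmb constEmb_injective hinvc hinvp)}
  (Rm : ConstantMultiple.RootMorphismData
    (ofConnectedTemperoidData h Q odd_l R ιX K' constEmb constEmb_injective hinvc hinvp) Vv)

/-- **`B_N^bs` of the genuine §5 datum is Galois**, in the form the model-case closers consume
(`IsGaloisObj (𝔉.base.obj 𝔉.BN).obj`).  [cite: MochizukiEtTh2009, §5 p.331 (PDF p.105)] -/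
theorem isGaloisObj_base_BN_obj_ofConnectedTemperoidData :
    SemiGraphs.IsGaloisObj
      ((ofConnectedTemperoidData h Q odd_l R ιX K' constEmb constEmb_injective hinvc hinvp).base.obj
        (ofConnectedTemperoidData h Q odd_l R ιX K' constEmb constEmb_injective hinvc hinvp).BN).obj :=
  BiKummerSetting.NthRoot.isGaloisObj_BN_base_obj R

/-- Hence every `D`-endomorphism of `B_N^bs` is an isomorphism at the genuine datum (the model case's tacit `hEnd`,
[SemiAnbd] Rmk. 3.1.6).  [cite: MochizukiSemiAnbd2006, Rmk 3.1.6 p.34] [cite: MochizukiEtTh2009, §5 p.331 (PDF p.105)] -/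
theorem isIso_endo_base_BN_ofConnectedTemperoidData
    (φ : (ofConnectedTemperoidData h Q odd_l R ιX K' constEmb constEmb_injective hinvc hinvp).base.obj
        (ofConnectedTemperoidData h Q odd_l R ιX K' constEmb constEmb_injective hinvc hinvp).BN ⟶
      (ofConnectedTemperoidData h Q odd_l R ιX K' constEmb constEmb_injective hinvc hinvp).base.obj
        (ofConnectedTemperoidData h Q odd_l R ιX K' constEmb constEmb_injective hinvc hinvp).BN) : IsIso φ :=
  (ofConnectedTemperoidData h Q odd_l R ιX K' constEmb constEmb_injective hinvc hinvp).isIso_endo_base_BN_of_isGaloisObj_obj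
    (isGaloisObj_base_BN_obj_ofConnectedTemperoidData h Q odd_l R ιX K' constEmb constEmb_injective hinvc hinvp) φ

/-- `A_N` of the genuine §5 datum is Frobenius-trivial (Def. 4.1 (iv)(a) / Prop. 4.2 (iii); "the Frobenius-trivial object `A_N`",
Cor. 5.12 proof p.341 l.9).  [cite: MochizukiEtTh2009, Def 4.1 (iv) p.313 (PDF p.87); Cor 5.12 proof p.341 (PDF p.115)] -/
theorem isFrobeniusTrivial_AN_ofConnectedTemperoidData :
    (ofConnectedTemperoidData h Q odd_l R ιX K' constEmb constEmb_injective hinvc hinvp).IsFrobeniusTrivial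
      (ofConnectedTemperoidData h Q odd_l R ιX K' constEmb constEmb_injective hinvc hinvp).AN :=
  BiKummerSetting.NthRoot.isFrobeniusTrivial_AN_ofModel R

/-- **[EtTh] Cor. 5.12 (i) at the GENUINE §5 data over `B^temp(Π^tp_X)⁰`** (F-0505 instance form): for every Cor. 5.12 datum
`Rm` over `ofConnectedTemperoidData …`, "The isomorphism classes of `A_N`, `B_N`, and `B_{N'}` are distinct" — modulo ONLY
print's §1 line-bundle sentences `hL`, `hL'` ("all positive tensor powers of these line bundles are nontrivial", p.341 l.5–6,
model form).  Every other input of the printed proof is a theorem at this datum (file header).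
[cite: MochizukiEtTh2009, Cor 5.12 (i) p.339 (PDF p.113), proof p.340–341 (PDF pp.114–115)] -/
theorem isoClassesDistinct_ofConnectedTemperoidData
    (hL : ∀ u : tf.ratFnFunctor.obj (op R.BN.base),
      R.BN.cls ≠ divB tf.divisorMonoid tf.ratFnFunctor tf.divBNatTrans (op R.BN.base) u)
    (hL' : ∀ k : ℕ, 0 < k → ∀ u : tf.ratFnFunctor.obj (op Rm.BN'.base),
      Rm.BN'.cls ^ k ≠ divB tf.divisorMonoid tf.ratFnFunctor tf.divBNatTrans (op Rm.BN'.base) u) :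
    ConstantMultiple.IsoClassesDistinct Rm :=
  Rm.isoClassesDistinct_of_model_of_isGaloisObj_obj rfl h.isDivisorial
    (isFrobeniusTrivial_AN_ofConnectedTemperoidData h Q odd_l R ιX K' constEmb constEmb_injective hinvc hinvp)
    (autAmpleBN_ofConnectedTemperoidData h Q odd_l R ιX K' constEmb constEmb_injective hinvc hinvp)
    (isGaloisObj_base_BN_obj_ofConnectedTemperoidData h Q odd_l R ιX K' constEmb constEmb_injective hinvc hinvp) hL hL'

/-- **[EtTh] Cor. 5.12 (iii) at the GENUINE §5 data, for every `ζ : B_{N'} → B_N`** (F-0501 instance form), modulo `hL`, `hL'`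
only — by abc-iut-L2-t4's PROVED reduction `constantMultipleIndeterminacy_of` (Lemma 5.11).
[cite: MochizukiEtTh2009, Cor 5.12 (iii) p.340 (PDF p.114), proof p.341 (PDF p.115)] -/
theorem constantMultipleIndeterminacy_ofConnectedTemperoidData
    (hL : ∀ u : tf.ratFnFunctor.obj (op R.BN.base),
      R.BN.cls ≠ divB tf.divisorMonoid tf.ratFnFunctor tf.divBNatTrans (op R.BN.base) u)
    (hL' : ∀ k : ℕ, 0 < k → ∀ u : tf.ratFnFunctor.obj (op Rm.BN'.base),
      Rm.BN'.cls ^ k ≠ divB tf.divisorMonoid tf.ratFnFunctor tf.divBNatTrans (op Rm.BN'.base) u)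
    (ζ : Rm.BN' ⟶ (ofConnectedTemperoidData h Q odd_l R ιX K' constEmb constEmb_injective hinvc hinvp).BN) :
    ConstantMultiple.ConstantMultipleIndeterminacy Rm ζ :=
  ConstantMultiple.constantMultipleIndeterminacy_of Rm
    (isoClassesDistinct_ofConnectedTemperoidData h Q odd_l R ιX K' constEmb constEmb_injective hinvc hinvp Rm hL hL') ζ

/-- **[EtTh] Cor. 5.12 (ii) at the GENUINE §5 data** (F-0503 instance form): a linear `ι : B_{N'} → B_N` exists, given that the
`N'`-datum's `A_{N'}` is Frobenius-trivial and `s^⊓_{N'}` is a pre-step (Prop. 4.2 (iii) for `N'`; carried by `RootMorphismData`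
only through the vocabulary stub `Vv`) — `B` group-like is `h.isGroupLike_rat`.
[cite: MochizukiEtTh2009, Cor 5.12 (ii) p.340 (PDF p.114), proof p.341 (PDF p.115)] -/
theorem existsLinearIota_ofConnectedTemperoidData
    (hA' : (ofConnectedTemperoidData h Q odd_l R ιX K' constEmb constEmb_injective hinvc hinvp).IsFrobeniusTrivial Rm.AN')
    (hs' : (ofConnectedTemperoidData h Q odd_l R ιX K' constEmb constEmb_injective hinvc hinvp).IsPreStep Rm.sCap') :
    ConstantMultiple.ExistsLinearIota Rm :=
  Rm.existsLinearIota_of_model rfl h.isGroupLike_rat hA' hs'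

/-- **[EtTh] Cor. 5.12 — (i), (ii), (iii) — at the GENUINE §5 data over `B^temp(Π^tp_X)⁰`** (F-0502 instance form), modulo the
§1 line-bundle sentences `hL`, `hL'` and the two Prop. 4.2 (iii) clauses `hA'`, `hs'` on the `N'`-datum; everything else
(operations, divisoriality, group-likeness, `A_N` Frobenius-trivial, `B_N` Aut-ample, `B_N` Galois ⇒ `End = Aut`) discharged.
[cite: MochizukiEtTh2009, Cor 5.12 p.339–341 (PDF pp.113–115)] -/
theorem constantMultipleIndeterminacyOfSystems_ofConnectedTemperoidData
    (hA' : (ofConnectedTemperoidData h Q odd_l R ιX K' constEmb constEmb_injective hinvc hinvp).IsFrobeniusTrivial Rm.AN')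
    (hs' : (ofConnectedTemperoidData h Q odd_l R ιX K' constEmb constEmb_injective hinvc hinvp).IsPreStep Rm.sCap')
    (hL : ∀ u : tf.ratFnFunctor.obj (op R.BN.base),
      R.BN.cls ≠ divB tf.divisorMonoid tf.ratFnFunctor tf.divBNatTrans (op R.BN.base) u)
    (hL' : ∀ k : ℕ, 0 < k → ∀ u : tf.ratFnFunctor.obj (op Rm.BN'.base),
      Rm.BN'.cls ^ k ≠ divB tf.divisorMonoid tf.ratFnFunctor tf.divBNatTrans (op Rm.BN'.base) u) :
    ConstantMultiple.ConstantMultipleIndeterminacyOfSystems Rm :=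
  Rm.constantMultipleIndeterminacyOfSystems_of_model_of_isGaloisObj_obj rfl h.isDivisorial h.isGroupLike_rat
    (isFrobeniusTrivial_AN_ofConnectedTemperoidData h Q odd_l R ιX K' constEmb constEmb_injective hinvc hinvp) hA' hs'
    (autAmpleBN_ofConnectedTemperoidData h Q odd_l R ιX K' constEmb constEmb_injective hinvc hinvp)
    (isGaloisObj_base_BN_obj_ofConnectedTemperoidData h Q odd_l R ιX K' constEmb constEmb_injective hinvc hinvp) hL hL'

end ThetaFrobenioid

end Literature.AnabelianGeometry.EtaleTheta

end
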